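import Summits.ABC.IUTFork.ForkGenuineRatInputs
import Summits.ABC.IUTFork.ForkGenuineDepthRatCensus
import Summits.ABC.IUTFork.LDHGenuine
import HarnessLib

/-!
# The fork at [IUTchIII] Corollary 3.12 at a GENUINE input: over `F₀ = K = ℚ` the NONARCHIMEDEAN form — Dupuy–Hilado's (1.1) —
# FAILS for EVERY input (skeleton XXVIIe-d)

Record-only file (D-0012) of the abc-iut cell (deliverable (a), skeleton seat abc-iut-skel, gen 9); TAKES NO SIDE.
Corollary of `ForkGenuineRatInputs.lean` (XXVIIe-c, p446091: `negLogThetaNonarch I = −deĝ̲_lgp(P_Θ)` EXACTLY for every input over `ℚ/ℚ`).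
The cell types [IUTchIII] Cor. 3.12 for a genuine Θ-volume input in two forms (abc-iut-S2, `GenuineLogTheta.lean`): Mochizuki's
`Cor312Of I` ("`−|log(q)| ≤ −|log(Θ)|`" WITH the archimedean summand `((l+5)/4)·log π` of [IUTchIV] Step (vii)) and Dupuy–Hilado's
NONARCHIMEDEAN (1.1) `Cor312NonarchOf I` ("`−deĝ̲(P_q) ≤ ln ν̄_𝕃(hull(U_Θ))`", arXiv:2004.13228 §1 (1.1); = the summit-side
`DHData.Cor312DH` of `DHData.ofInput I` by c312-3's `cor312DH_ofInput_iff`), the STRONGER of the two. Over `ℚ/ℚ`: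

* **`not_cor312NonarchOf_rat`** — `¬ Cor312NonarchOf I` for EVERY `I : ThetaVolumeInput ℚ ℚ`: (1.1) needs STRICT inflation of the bare
  Θ-region (`deĝ̲(P_q) < deĝ̲_lgp(P_Θ)`, c312-3's `lnνL_region_lt_of_cor312DH`), and over `ℚ/ℚ` there is NONE at any prime;
* **`not_cor312DH_ofInput_rat`** — the same for the Dupuy–Hilado datum `DHData.ofInput I`;
* `not_cor312PerImageNonarchOf_rat` — and in reading (P);
* `cor312Of_rat_iff_arch` — whereas Mochizuki's form holds iff the archimedean summand ALONE pays the gap (XXVIIe-c's `cor312Of_rat_iff`,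
  restated side by side): over `ℚ/ℚ` the two printed forms of the inequality DIFFER in truth value exactly on the shallow window
  `0 < κ_l·deĝ̲(𝔮) ≤ ((l+5)/4)·log π`.

READING (grammar of `HOME/skel/FORK-REAL-MODEL.md` §11/§13; no side taken): on the zero-inflation control group the nonarchimedean (1.1) is
identically false and Mochizuki's form is the shallow condition — the archimedean term is the whole difference. HONEST SCOPE: synthetic inputs
(`K = ℚ` never carries initial Θ-data: `√−1 ∈ F ⊆ K`); statements about OUR typed numbers; nothing here bears on whether [IUTchIII] Thm. 3.11
licenses Cor. 3.12, nor on (1.1) at genuine data; typed ≠ proved. PROOF-ONLY file: no definitions, no `Prop` facts.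
[cite: DupuyHilado2025, §1 (1.1), §3.3, Thm. 3.10.1] [cite: Mochizuki2012, IUTchIII Cor. 3.12 p. 173–174] [cite: Mochizuki2012, IUTchIV Thm. 1.10
Step (vii) p. 30] [claim: Mochizuki2012, status: disputed]
-/

noncomputable section

open Literature.IUT.LogVolume NumberField IsDedekindDomain

namespace Summit.ABC.IUTFork.GenuineContent

section RatDH

variable (I : ThetaVolumeInput ℚ ℚ)

/-- **Dupuy–Hilado's (1.1) FAILS for every input over `ℚ/ℚ`**: `¬ Cor312NonarchOf I` — `negLogThetaNonarch I = −deĝ̲_lgp(P_Θ)` (XXVIIe-c) while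
`deĝ̲(P_q) < deĝ̲_lgp(P_Θ)` (`P_{Θ,j} = j²·P_q`, `ℓ⋇ ≥ 2`). HYPOTHESIS-shaped `Prop` refuted on OUR typed numbers at synthetic inputs; no side taken on the
printed (1.1) at genuine data. [cite: DupuyHilado2025, §1 (1.1), §3.3] [claim: Mochizuki2012, status: disputed] -/
theorem not_cor312NonarchOf_rat : ¬ I.Cor312NonarchOf := by
  unfold ThetaVolumeInput.Cor312NonarchOf ThetaVolumeInput.negAbsLogQ
  rw [negLogThetaNonarch_rat_eq, not_le, neg_lt_neg_iff, FinDivisor.ndeg_apply, LgpDivisor.ndegLgp_eq]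
  exact div_lt_div_of_pos_right I.X.deg_qPilot_lt_degLgp_thetaPilot FinDivisor.finrank_pos

/-- **… equivalently for the Dupuy–Hilado datum of the input**: `¬ (DHData.ofInput I).Cor312DH` (c312-3's bridge `cor312DH_ofInput_iff`).
[cite: DupuyHilado2025, §1 (1.1)] [claim: Mochizuki2012, status: disputed] -/
theorem not_cor312DH_ofInput_rat : ¬ (DHData.ofInput I).Cor312DH := fun h =>
  not_cor312NonarchOf_rat I ((DHData.cor312DH_ofInput_iff I).mp h)

/-- **… and in reading (P)**: `¬ Cor312PerImageNonarchOf I` (the (P)-form implies the (U)-form, c312-d1).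
[cite: DupuyHilado2025, §1 (1.1)] [claim: Mochizuki2012, status: disputed] -/
theorem not_cor312PerImageNonarchOf_rat : ¬ I.Cor312PerImageNonarchOf := fun h =>
  not_cor312NonarchOf_rat I (DHData.cor312NonarchOf_of_cor312PerImageNonarchOf I h)

/-- **The two printed forms side by side over `ℚ/ℚ`**: Dupuy–Hilado's (1.1) is FALSE and Mochizuki's `Cor312Of I` holds iff
`deĝ̲_lgp(P_Θ) − deĝ̲(P_q) ≤ ((l+5)/4)·log π` — the archimedean summand of [IUTchIV] Step (vii) is the whole difference, and the two forms
disagree exactly on the shallow window. [cite: Mochizuki2012, IUTchIV Thm. 1.10 Step (vii) p. 30] [cite: DupuyHilado2025, §1 (1.1)]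
[claim: Mochizuki2012, status: disputed] -/
theorem cor312Of_rat_iff_arch :
    ¬ I.Cor312NonarchOf ∧
      (I.Cor312Of ↔ LgpDivisor.ndegLgp I.X.thetaPilot - FinDivisor.ndeg ℚ I.X.qPilot ≤ ThetaVolumeInput.archLogTheta I.l) :=
  ⟨not_cor312NonarchOf_rat I, cor312Of_rat_iff I⟩

/-- **Non-vacuity of the disagreement**: there is an input over `ℚ/ℚ` at which Mochizuki's form HOLDS while Dupuy–Hilado's (1.1) FAILS
(`deepAt 2 5 1 σ` of XXVIIe-b's census). [cite: Mochizuki2012, IUTchIII Cor. 3.12 p. 173–174] [cite: DupuyHilado2025, §1 (1.1)]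
[claim: Mochizuki2012, status: disputed] -/
theorem exists_rat_input_cor312Of_and_not_cor312NonarchOf :
    ∃ I : ThetaVolumeInput ℚ ℚ, I.Cor312Of ∧ ¬ I.Cor312NonarchOf := by
  obtain ⟨I, -, hI, -⟩ := exists_rat_inputs_both_sides
  exact ⟨I, hI, not_cor312NonarchOf_rat I⟩

end RatDH

end Summit.ABC.IUTFork.GenuineContent

end
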